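import Summits.Ventures.CertifiedManyBodySolver.Downfold.EmeryBoxesSLCOThermalCapRetiltBoxp1
import Literature.MathematicalPhysics.QuantumLattice.EmeryThreeBandThermalMarkovCap
import HarnessLib

/-!
# ENTROPY-RESOLVED `T > 0` CAP WORD on `emeryBoxSLCOClass` (level εp = -59/5): the four kgp1x5 corner sector tables, re-tilted SECTOR-WISE to the common level and read through
# the Markov / conditional-entropy law of the `CuO₄` plus — `48.3066·β + 6 log 2 → maxᵢ log Fᵢ(β)` (`48.3066·β + 2.7081` for large β); hubbard-box-p1 g22, by value

Venture CertifiedManyBodySolver, cell `pub/hubbard-downfold` (S1 = ROUTER) × crew hubbard-fast S2 (ii) × (iv) «T > 0 × multi-band» (D-0096 (ii)); seat hubbard-box-p1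
(row «joint laws; box ⊂ ∪ cells ⇒ word»), by value for the word owner hubbard-downfold-mod-4. Namespace `Summit.Ventures.CertifiedManyBodySolver.Downfold`.
Same construction as `EmeryThermalMarkovCapLa214Boxp1` (La₂CuO₄ #18, p668548).

INPUTS BY NAME: `EmeryBoxesSLCOThermalCapRetiltBoxp1` (dictionary-form tables `slcoClassFloor_table i` of box-p2's `kgp1x5_<c>_sigma/_table`, SLCOx_c0_ll_mum118o10, SLCOx_c1_hl_mum120o10, SLCOx_c2_lh_mum120o10, SLCOx_c3_hh_mum122o10; tilts
`μ = (-59/5, -12, -12, -61/5)`; its FLAT re-tilted word `emeryBoxSLCOClass_pressureCap_m59o5_retilt`: `P_cell ≤ 6 log 2 + β·966131563/20000000`); the Literature laws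
`EmeryThreeBandThermalMarkovCap.emeryCellPressure_le_log_of_gpSectorFloors` (Markov cap of the plus from sector floors: `P_cell ≤ log max_{n≤4} Σ_{j≤6} C(6,j)·e^{−(β/M)q(j+n)}`)
and `EmeryThreeBandCuO4CertificateRetilt.sectorFloors_plusGP_retilt` (`qᵢ(k) = σᵢ(k) + max(cᵢ·k + min(0,2cᵢ), 2cᵢ·k − 4·max(0,2cᵢ))`, `cᵢ = εp − μᵢ = (0, 1/5, 1/5, 2/5)`);
the box door `holdsOn_emeryCellPressureCap_of_cornerCaps` (`EmeryThermalSeam`, convexity of the pressure in the couplings) with `emeryLine_lowerCorner_level` / `slcoClass_lowerCorner`.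

BY VALUE [float, `gen-g22/gen_markov_box.py`; exact rationals inside the theorems]: box word at εp = -59/5, flat re-tilted `48.3066·β + 6 log 2` vs Markov `maxᵢ log Fᵢ(β)`:
| β (1/eV) | flat | Markov | gain (nats/CuO₂) |
|---|---|---|---|
| 0.05 | 6.574 | 6.391 | 0.183 |
| 0.1 | 8.990 | 8.653 | 0.337 |
| 0.5 | 28.312 | 27.356 | 0.956 |
| 1 | 52.465 | 51.299 | 1.166 |
| 5 | 245.692 | 244.299 | 1.393 |
| 10 | 487.225 | 485.783 | 1.442 |
| 40 | 1936.422 | 1934.971 | 1.451 |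
(asymptotic gain `1.4508`; corner 3 binds in sector k = 8). HONEST FRAMING: CERTIFIED inequalities on a SCREENING-GRADE object (box ends [float]/DFT, locators in
the router's BOXES files); the improvement is in the CONSTANT only (of the `6 log 2 = 4.159`), the β-slope `48.3066` is the `T = 0` floor's and the cap−floor
slope mismatch is unchanged — thermal scales are NOT resolved; grand-canonical statements at a stated level; no phase word; no router number moves.
WHAT-THIS-IS-NOT: a certificate or a number of record — a reading of existing kernel tables through a new law (zero kit).
-/

noncomputable section

namespace Summit.Ventures.CertifiedManyBodySolver.Downfold

open NonemptyInterval Matrix Finset Literature.Probability.LatticeModels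
open Literature.MathematicalPhysics.QuantumLattice Literature.Computation.Certificates
open Summit.Ventures.CertifiedManyBodySolver.Certificates OccupationCode ClusterLowerBound
open scoped BigOperators ComplexOrder

/-- Each Markov sum is positive (its `j = 0` term is an exponential). [folklore] -/
private theorem sum_choose_exp_pos' (g : ℕ → ℝ) : 0 < ∑ j ∈ Finset.range 7, ((Nat.choose 6 j : ℕ) : ℝ) * Real.exp (g j) :=
  lt_of_lt_of_le (mul_pos (by norm_num) (Real.exp_pos (g 0)))
    (Finset.single_le_sum (f := fun j => ((Nat.choose 6 j : ℕ) : ℝ) * Real.exp (g j)) (fun j _ => by positivity)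
      (Finset.mem_range.2 (by norm_num)))

/-! ## §1 The four sector tables re-tilted to the common level εp = -59/5, sector by sector -/

/-- **Corner 0, level -59/5** (from tilt `-59/5`, `c = 0`): `σ_0(k) + max(0·k + min(0, 2·0), 2·0·k − 4·max(0, 2·0)) ≤ E₀(h^G(θ_0 + (-59/5)·ε), k)`, `k ≤ 10`.
[cite: KullEtAl2024, §5.3] [cite: ValentiStolzeHirschfeld1991, §II] -/
theorem slcoClassMarkovTable_m59o5_c0 : ∀ k ≤ 10,
    ((kgp1x5_SLCOx_c0_ll_mum118o10_sigma k : ℚ) : ℝ) + max ((0 : ℝ) * 2 / 2 * k + min 0 ((0 : ℝ) * 2)) ((0 : ℝ) * 2 * k - 4 * max 0 ((0 : ℝ) * 2)) ≤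
      groundEnergy (hubbardOpenBoxGP 1 5 (plusTau (emeryLine cuprateSigns (slcoClassCorner 0) + ((-59/5 : ℚ) : ℝ) • levelDir) 2)
        (plusUps (emeryLine cuprateSigns (slcoClassCorner 0) + ((-59/5 : ℚ) : ℝ) • levelDir) 2)
        (plusNu (emeryLine cuprateSigns (slcoClassCorner 0) + ((-59/5 : ℚ) : ℝ) • levelDir) 2)) k := by
  have h := sectorFloors_plusGP_retilt (emeryLine cuprateSigns (slcoClassCorner 0) + (-59/5 : ℝ) • levelDir) 2 (0 : ℝ) slcoClassFloor_table0
  rw [tilt_add_retilt, show (-59/5 : ℝ) + 0 = ((-59/5 : ℚ) : ℝ) by norm_num] at h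
  exact h

/-- **Corner 1, level -59/5** (from tilt `-12`, `c = 1/5`): `σ_1(k) + max(1/5·k + min(0, 2·1/5), 2·1/5·k − 4·max(0, 2·1/5)) ≤ E₀(h^G(θ_1 + (-59/5)·ε), k)`, `k ≤ 10`.
[cite: KullEtAl2024, §5.3] [cite: ValentiStolzeHirschfeld1991, §II] -/
theorem slcoClassMarkovTable_m59o5_c1 : ∀ k ≤ 10,
    ((kgp1x5_SLCOx_c1_hl_mum120o10_sigma k : ℚ) : ℝ) + max ((1/5 : ℝ) * 2 / 2 * k + min 0 ((1/5 : ℝ) * 2)) ((1/5 : ℝ) * 2 * k - 4 * max 0 ((1/5 : ℝ) * 2)) ≤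
      groundEnergy (hubbardOpenBoxGP 1 5 (plusTau (emeryLine cuprateSigns (slcoClassCorner 1) + ((-59/5 : ℚ) : ℝ) • levelDir) 2)
        (plusUps (emeryLine cuprateSigns (slcoClassCorner 1) + ((-59/5 : ℚ) : ℝ) • levelDir) 2)
        (plusNu (emeryLine cuprateSigns (slcoClassCorner 1) + ((-59/5 : ℚ) : ℝ) • levelDir) 2)) k := by
  have h := sectorFloors_plusGP_retilt (emeryLine cuprateSigns (slcoClassCorner 1) + (-12 : ℝ) • levelDir) 2 (1/5 : ℝ) slcoClassFloor_table1
  rw [tilt_add_retilt, show (-12 : ℝ) + 1/5 = ((-59/5 : ℚ) : ℝ) by norm_num] at h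
  exact h

/-- **Corner 2, level -59/5** (from tilt `-12`, `c = 1/5`): `σ_2(k) + max(1/5·k + min(0, 2·1/5), 2·1/5·k − 4·max(0, 2·1/5)) ≤ E₀(h^G(θ_2 + (-59/5)·ε), k)`, `k ≤ 10`.
[cite: KullEtAl2024, §5.3] [cite: ValentiStolzeHirschfeld1991, §II] -/
theorem slcoClassMarkovTable_m59o5_c2 : ∀ k ≤ 10,
    ((kgp1x5_SLCOx_c2_lh_mum120o10_sigma k : ℚ) : ℝ) + max ((1/5 : ℝ) * 2 / 2 * k + min 0 ((1/5 : ℝ) * 2)) ((1/5 : ℝ) * 2 * k - 4 * max 0 ((1/5 : ℝ) * 2)) ≤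
      groundEnergy (hubbardOpenBoxGP 1 5 (plusTau (emeryLine cuprateSigns (slcoClassCorner 2) + ((-59/5 : ℚ) : ℝ) • levelDir) 2)
        (plusUps (emeryLine cuprateSigns (slcoClassCorner 2) + ((-59/5 : ℚ) : ℝ) • levelDir) 2)
        (plusNu (emeryLine cuprateSigns (slcoClassCorner 2) + ((-59/5 : ℚ) : ℝ) • levelDir) 2)) k := by
  have h := sectorFloors_plusGP_retilt (emeryLine cuprateSigns (slcoClassCorner 2) + (-12 : ℝ) • levelDir) 2 (1/5 : ℝ) slcoClassFloor_table2
  rw [tilt_add_retilt, show (-12 : ℝ) + 1/5 = ((-59/5 : ℚ) : ℝ) by norm_num] at h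
  exact h

/-- **Corner 3, level -59/5** (from tilt `-61/5`, `c = 2/5`): `σ_3(k) + max(2/5·k + min(0, 2·2/5), 2·2/5·k − 4·max(0, 2·2/5)) ≤ E₀(h^G(θ_3 + (-59/5)·ε), k)`, `k ≤ 10`.
[cite: KullEtAl2024, §5.3] [cite: ValentiStolzeHirschfeld1991, §II] -/
theorem slcoClassMarkovTable_m59o5_c3 : ∀ k ≤ 10,
    ((kgp1x5_SLCOx_c3_hh_mum122o10_sigma k : ℚ) : ℝ) + max ((2/5 : ℝ) * 2 / 2 * k + min 0 ((2/5 : ℝ) * 2)) ((2/5 : ℝ) * 2 * k - 4 * max 0 ((2/5 : ℝ) * 2)) ≤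
      groundEnergy (hubbardOpenBoxGP 1 5 (plusTau (emeryLine cuprateSigns (slcoClassCorner 3) + ((-59/5 : ℚ) : ℝ) • levelDir) 2)
        (plusUps (emeryLine cuprateSigns (slcoClassCorner 3) + ((-59/5 : ℚ) : ℝ) • levelDir) 2)
        (plusNu (emeryLine cuprateSigns (slcoClassCorner 3) + ((-59/5 : ℚ) : ℝ) • levelDir) 2)) k := by
  have h := sectorFloors_plusGP_retilt (emeryLine cuprateSigns (slcoClassCorner 3) + (-61/5 : ℝ) • levelDir) 2 (2/5 : ℝ) slcoClassFloor_table3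
  rw [tilt_add_retilt, show (-61/5 : ℝ) + 2/5 = ((-59/5 : ℚ) : ℝ) by norm_num] at h
  exact h

/-! ## §2 The four entropy-resolved corner caps at level εp = -59/5 -/

/-- **CORNER 0, entropy-resolved cap** at level -59/5 (every β ≥ 0): `P_cell ≤ log max_{n≤4} Σ_{j≤6} C(6,j)·e^{−(β/2)·q_0(j+n)}`, `q_0(k) = σ_0(k) + max(0·k + min(0,2·0), 2·0·k − 4·max(0,2·0))`.
[cite: PoulinHastings2011, eqs. (3)–(8)] [cite: Israel1979, Thm. I.2.4] -/
theorem emeryBoxSLCOClass_corner0_pressureCap_m59o5_markov {β : ℝ} (hβ : 0 ≤ β) :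
    emeryCellPressure β (emeryLine cuprateSigns (slcoClassCorner 0) + ((-59/5 : ℚ) : ℝ) • levelDir) ≤
      Real.log ((Finset.range 5).sup' ⟨0, by simp⟩ fun n => ∑ j ∈ Finset.range 7, ((Nat.choose 6 j : ℕ) : ℝ) *
        Real.exp (-(β / 2 * (((kgp1x5_SLCOx_c0_ll_mum118o10_sigma (j + n) : ℚ) : ℝ) +
          max ((0 : ℝ) * 2 / 2 * (j + n : ℕ) + min 0 ((0 : ℝ) * 2)) ((0 : ℝ) * 2 * (j + n : ℕ) - 4 * max 0 ((0 : ℝ) * 2)))))) := by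
  refine emeryCellPressure_le_log_of_gpSectorFloors _ (M := 2) two_pos hβ _ slcoClassMarkovTable_m59o5_c0 ?_ fun n hn => ?_
  · exact lt_of_lt_of_le (sum_choose_exp_pos' _) (Finset.le_sup' (fun n => ∑ j ∈ Finset.range 7, ((Nat.choose 6 j : ℕ) : ℝ) *
        Real.exp (-(β / 2 * (((kgp1x5_SLCOx_c0_ll_mum118o10_sigma (j + n) : ℚ) : ℝ) +
          max ((0 : ℝ) * 2 / 2 * (j + n : ℕ) + min 0 ((0 : ℝ) * 2)) ((0 : ℝ) * 2 * (j + n : ℕ) - 4 * max 0 ((0 : ℝ) * 2)))))) (Finset.mem_range.2 (by norm_num : 0 < 5)))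
  · exact Finset.le_sup' (fun n => ∑ j ∈ Finset.range 7, ((Nat.choose 6 j : ℕ) : ℝ) *
        Real.exp (-(β / 2 * (((kgp1x5_SLCOx_c0_ll_mum118o10_sigma (j + n) : ℚ) : ℝ) +
          max ((0 : ℝ) * 2 / 2 * (j + n : ℕ) + min 0 ((0 : ℝ) * 2)) ((0 : ℝ) * 2 * (j + n : ℕ) - 4 * max 0 ((0 : ℝ) * 2)))))) (Finset.mem_range.2 (by omega))

/-- **CORNER 1, entropy-resolved cap** at level -59/5 (every β ≥ 0): `P_cell ≤ log max_{n≤4} Σ_{j≤6} C(6,j)·e^{−(β/2)·q_1(j+n)}`, `q_1(k) = σ_1(k) + max(1/5·k + min(0,2·1/5), 2·1/5·k − 4·max(0,2·1/5))`.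
[cite: PoulinHastings2011, eqs. (3)–(8)] [cite: Israel1979, Thm. I.2.4] -/
theorem emeryBoxSLCOClass_corner1_pressureCap_m59o5_markov {β : ℝ} (hβ : 0 ≤ β) :
    emeryCellPressure β (emeryLine cuprateSigns (slcoClassCorner 1) + ((-59/5 : ℚ) : ℝ) • levelDir) ≤
      Real.log ((Finset.range 5).sup' ⟨0, by simp⟩ fun n => ∑ j ∈ Finset.range 7, ((Nat.choose 6 j : ℕ) : ℝ) *
        Real.exp (-(β / 2 * (((kgp1x5_SLCOx_c1_hl_mum120o10_sigma (j + n) : ℚ) : ℝ) +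
          max ((1/5 : ℝ) * 2 / 2 * (j + n : ℕ) + min 0 ((1/5 : ℝ) * 2)) ((1/5 : ℝ) * 2 * (j + n : ℕ) - 4 * max 0 ((1/5 : ℝ) * 2)))))) := by
  refine emeryCellPressure_le_log_of_gpSectorFloors _ (M := 2) two_pos hβ _ slcoClassMarkovTable_m59o5_c1 ?_ fun n hn => ?_
  · exact lt_of_lt_of_le (sum_choose_exp_pos' _) (Finset.le_sup' (fun n => ∑ j ∈ Finset.range 7, ((Nat.choose 6 j : ℕ) : ℝ) *
        Real.exp (-(β / 2 * (((kgp1x5_SLCOx_c1_hl_mum120o10_sigma (j + n) : ℚ) : ℝ) +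
          max ((1/5 : ℝ) * 2 / 2 * (j + n : ℕ) + min 0 ((1/5 : ℝ) * 2)) ((1/5 : ℝ) * 2 * (j + n : ℕ) - 4 * max 0 ((1/5 : ℝ) * 2)))))) (Finset.mem_range.2 (by norm_num : 0 < 5)))
  · exact Finset.le_sup' (fun n => ∑ j ∈ Finset.range 7, ((Nat.choose 6 j : ℕ) : ℝ) *
        Real.exp (-(β / 2 * (((kgp1x5_SLCOx_c1_hl_mum120o10_sigma (j + n) : ℚ) : ℝ) +
          max ((1/5 : ℝ) * 2 / 2 * (j + n : ℕ) + min 0 ((1/5 : ℝ) * 2)) ((1/5 : ℝ) * 2 * (j + n : ℕ) - 4 * max 0 ((1/5 : ℝ) * 2)))))) (Finset.mem_range.2 (by omega))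

/-- **CORNER 2, entropy-resolved cap** at level -59/5 (every β ≥ 0): `P_cell ≤ log max_{n≤4} Σ_{j≤6} C(6,j)·e^{−(β/2)·q_2(j+n)}`, `q_2(k) = σ_2(k) + max(1/5·k + min(0,2·1/5), 2·1/5·k − 4·max(0,2·1/5))`.
[cite: PoulinHastings2011, eqs. (3)–(8)] [cite: Israel1979, Thm. I.2.4] -/
theorem emeryBoxSLCOClass_corner2_pressureCap_m59o5_markov {β : ℝ} (hβ : 0 ≤ β) :
    emeryCellPressure β (emeryLine cuprateSigns (slcoClassCorner 2) + ((-59/5 : ℚ) : ℝ) • levelDir) ≤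
      Real.log ((Finset.range 5).sup' ⟨0, by simp⟩ fun n => ∑ j ∈ Finset.range 7, ((Nat.choose 6 j : ℕ) : ℝ) *
        Real.exp (-(β / 2 * (((kgp1x5_SLCOx_c2_lh_mum120o10_sigma (j + n) : ℚ) : ℝ) +
          max ((1/5 : ℝ) * 2 / 2 * (j + n : ℕ) + min 0 ((1/5 : ℝ) * 2)) ((1/5 : ℝ) * 2 * (j + n : ℕ) - 4 * max 0 ((1/5 : ℝ) * 2)))))) := by
  refine emeryCellPressure_le_log_of_gpSectorFloors _ (M := 2) two_pos hβ _ slcoClassMarkovTable_m59o5_c2 ?_ fun n hn => ?_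
  · exact lt_of_lt_of_le (sum_choose_exp_pos' _) (Finset.le_sup' (fun n => ∑ j ∈ Finset.range 7, ((Nat.choose 6 j : ℕ) : ℝ) *
        Real.exp (-(β / 2 * (((kgp1x5_SLCOx_c2_lh_mum120o10_sigma (j + n) : ℚ) : ℝ) +
          max ((1/5 : ℝ) * 2 / 2 * (j + n : ℕ) + min 0 ((1/5 : ℝ) * 2)) ((1/5 : ℝ) * 2 * (j + n : ℕ) - 4 * max 0 ((1/5 : ℝ) * 2)))))) (Finset.mem_range.2 (by norm_num : 0 < 5)))
  · exact Finset.le_sup' (fun n => ∑ j ∈ Finset.range 7, ((Nat.choose 6 j : ℕ) : ℝ) *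
        Real.exp (-(β / 2 * (((kgp1x5_SLCOx_c2_lh_mum120o10_sigma (j + n) : ℚ) : ℝ) +
          max ((1/5 : ℝ) * 2 / 2 * (j + n : ℕ) + min 0 ((1/5 : ℝ) * 2)) ((1/5 : ℝ) * 2 * (j + n : ℕ) - 4 * max 0 ((1/5 : ℝ) * 2)))))) (Finset.mem_range.2 (by omega))

/-- **CORNER 3, entropy-resolved cap** at level -59/5 (every β ≥ 0): `P_cell ≤ log max_{n≤4} Σ_{j≤6} C(6,j)·e^{−(β/2)·q_3(j+n)}`, `q_3(k) = σ_3(k) + max(2/5·k + min(0,2·2/5), 2·2/5·k − 4·max(0,2·2/5))`.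
[cite: PoulinHastings2011, eqs. (3)–(8)] [cite: Israel1979, Thm. I.2.4] -/
theorem emeryBoxSLCOClass_corner3_pressureCap_m59o5_markov {β : ℝ} (hβ : 0 ≤ β) :
    emeryCellPressure β (emeryLine cuprateSigns (slcoClassCorner 3) + ((-59/5 : ℚ) : ℝ) • levelDir) ≤
      Real.log ((Finset.range 5).sup' ⟨0, by simp⟩ fun n => ∑ j ∈ Finset.range 7, ((Nat.choose 6 j : ℕ) : ℝ) *
        Real.exp (-(β / 2 * (((kgp1x5_SLCOx_c3_hh_mum122o10_sigma (j + n) : ℚ) : ℝ) +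
          max ((2/5 : ℝ) * 2 / 2 * (j + n : ℕ) + min 0 ((2/5 : ℝ) * 2)) ((2/5 : ℝ) * 2 * (j + n : ℕ) - 4 * max 0 ((2/5 : ℝ) * 2)))))) := by
  refine emeryCellPressure_le_log_of_gpSectorFloors _ (M := 2) two_pos hβ _ slcoClassMarkovTable_m59o5_c3 ?_ fun n hn => ?_
  · exact lt_of_lt_of_le (sum_choose_exp_pos' _) (Finset.le_sup' (fun n => ∑ j ∈ Finset.range 7, ((Nat.choose 6 j : ℕ) : ℝ) *
        Real.exp (-(β / 2 * (((kgp1x5_SLCOx_c3_hh_mum122o10_sigma (j + n) : ℚ) : ℝ) +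
          max ((2/5 : ℝ) * 2 / 2 * (j + n : ℕ) + min 0 ((2/5 : ℝ) * 2)) ((2/5 : ℝ) * 2 * (j + n : ℕ) - 4 * max 0 ((2/5 : ℝ) * 2)))))) (Finset.mem_range.2 (by norm_num : 0 < 5)))
  · exact Finset.le_sup' (fun n => ∑ j ∈ Finset.range 7, ((Nat.choose 6 j : ℕ) : ℝ) *
        Real.exp (-(β / 2 * (((kgp1x5_SLCOx_c3_hh_mum122o10_sigma (j + n) : ℚ) : ℝ) +
          max ((2/5 : ℝ) * 2 / 2 * (j + n : ℕ) + min 0 ((2/5 : ℝ) * 2)) ((2/5 : ℝ) * 2 * (j + n : ℕ) - 4 * max 0 ((2/5 : ℝ) * 2)))))) (Finset.mem_range.2 (by omega))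

/-! ## §3 The box word -/

/-- **THE ENTROPY-RESOLVED `T > 0` CAP WORD on `emeryBoxSLCOClass`** (hypothesis-free, every β ≥ 0, every point, level εp = -59/5 ⇔ chemical potential `59/5` eV):
`P_cell(β) ≤ maxᵢ log Fᵢ(β)` with the four corner functions of §2 [float: `48.3066·β + 2.7081` for large β versus the flat re-tilted word
`48.3066·β + 4.1589` of `emeryBoxSLCOClass_pressureCap_m59o5_retilt`]. [cite: Israel1979, Thm. I.3.4] [cite: PoulinHastings2011, eqs. (3)–(8)] -/
theorem emeryBoxSLCOClass_pressureCap_m59o5_markov {β : ℝ} (hβ : 0 ≤ β) :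
    HoldsOn (fun p : EmeryCoord → ℝ =>
      emeryCellPressure β (emeryLine cuprateSigns (emeryLineCoords (((-59/5 : ℚ)) : ℝ) p)) ≤
        max (max
          (Real.log ((Finset.range 5).sup' ⟨0, by simp⟩ fun n => ∑ j ∈ Finset.range 7, ((Nat.choose 6 j : ℕ) : ℝ) *
        Real.exp (-(β / 2 * (((kgp1x5_SLCOx_c0_ll_mum118o10_sigma (j + n) : ℚ) : ℝ) +
          max ((0 : ℝ) * 2 / 2 * (j + n : ℕ) + min 0 ((0 : ℝ) * 2)) ((0 : ℝ) * 2 * (j + n : ℕ) - 4 * max 0 ((0 : ℝ) * 2)))))))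
          (Real.log ((Finset.range 5).sup' ⟨0, by simp⟩ fun n => ∑ j ∈ Finset.range 7, ((Nat.choose 6 j : ℕ) : ℝ) *
        Real.exp (-(β / 2 * (((kgp1x5_SLCOx_c1_hl_mum120o10_sigma (j + n) : ℚ) : ℝ) +
          max ((1/5 : ℝ) * 2 / 2 * (j + n : ℕ) + min 0 ((1/5 : ℝ) * 2)) ((1/5 : ℝ) * 2 * (j + n : ℕ) - 4 * max 0 ((1/5 : ℝ) * 2))))))))
          (max
          (Real.log ((Finset.range 5).sup' ⟨0, by simp⟩ fun n => ∑ j ∈ Finset.range 7, ((Nat.choose 6 j : ℕ) : ℝ) *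
        Real.exp (-(β / 2 * (((kgp1x5_SLCOx_c2_lh_mum120o10_sigma (j + n) : ℚ) : ℝ) +
          max ((1/5 : ℝ) * 2 / 2 * (j + n : ℕ) + min 0 ((1/5 : ℝ) * 2)) ((1/5 : ℝ) * 2 * (j + n : ℕ) - 4 * max 0 ((1/5 : ℝ) * 2)))))))
          (Real.log ((Finset.range 5).sup' ⟨0, by simp⟩ fun n => ∑ j ∈ Finset.range 7, ((Nat.choose 6 j : ℕ) : ℝ) *
        Real.exp (-(β / 2 * (((kgp1x5_SLCOx_c3_hh_mum122o10_sigma (j + n) : ℚ) : ℝ) +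
          max ((2/5 : ℝ) * 2 / 2 * (j + n : ℕ) + min 0 ((2/5 : ℝ) * 2)) ((2/5 : ℝ) * 2 * (j + n : ℕ) - 4 * max 0 ((2/5 : ℝ) * 2)))))))))
      emeryBoxSLCOClass := by
  refine holdsOn_emeryCellPressureCap_of_cornerCaps (E := emeryBoxSLCOClass) (eA := slcoClassEmery_tpd) (eB := slcoClassEmery_tpp) (eD := slcoClassEmery_Delta) (eUd := slcoClassEmery_Udd) (eUp := slcoClassEmery_Upp) rfl rfl rfl rfl rfl cuprateSigns hβ fun i => ?_
  rw [emeryLine_lowerCorner_level, slcoClass_lowerCorner]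
  fin_cases i
  · exact le_max_of_le_left (le_max_of_le_left (emeryBoxSLCOClass_corner0_pressureCap_m59o5_markov hβ))
  · exact le_max_of_le_left (le_max_of_le_right (emeryBoxSLCOClass_corner1_pressureCap_m59o5_markov hβ))
  · exact le_max_of_le_right (le_max_of_le_left (emeryBoxSLCOClass_corner2_pressureCap_m59o5_markov hβ))
  · exact le_max_of_le_right (le_max_of_le_right (emeryBoxSLCOClass_corner3_pressureCap_m59o5_markov hβ))

end Summit.Ventures.CertifiedManyBodySolver.Downfold

end
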